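import Summits.ResolutionOfSingularities.ResolutionOfSingularities.Theorems.FrobeniusLadderFInjectiveMacaulayficationExceptionalSlices
import Summits.ResolutionOfSingularities.ResolutionOfSingularities.Theorems.FrobeniusLadderFInjectiveMacaulayficationRegularExceptionalSlices
import HarnessLib

/-!
# R1 with an ARBITRARY centre («𝔪 ↦ 𝓘_D»): an exceptional slice that is CM + F-injective makes the blowing up FULL at that point
# (crux `FInjectiveMacaulayfication` stmt-ResolutionOfSingularities-15315, chain w45a, door v30; line T-F under #4β; RULING R15.18 (6)(iv))

[OURS · L1 W4.5a · res-L1-w45a-lead-1 gen 5] Support file (`--supports stmt-ResolutionOfSingularities-15315 --as helper`); NOT a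
statement of any manuscript; AI-written, weaker than expert review.

`ExceptionalSlices.pfixData_of_exceptionalSlices_holds` (res-L1-w45a-stub-3 over strat-1's §10⁗, Fedder's deformation via the tree theorem
`Deformation.cmfi_of_cmfi_quotient`) is stated for an `𝔪`-PRIMARY centre `(c)` of a LOCAL domain `A` and the chart primes over `𝔪`. The
argument is pointwise on the exceptional divisor and uses neither hypothesis: for ANY Noetherian domain `A` of characteristic `p`, ANY
nonzero generators `c`, and ANY prime `𝔔` of the chart `A[(c)/c_j]` CONTAINING `c_j/1` (a point of the exceptional Cartier divisor
`E = V(c_j)`), if the slice `A[(c)/c_j]_𝔔 / (c_j)` (the local ring of `E` at `𝔔`) satisfies the CM clause and the F-clause, then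
`A[(c)/c_j]_𝔔` is a domain satisfying the full crux clause (`clause_of_exceptionalSlice`). This is the form the LINE-centre instances use
(res-L1-w45a-plan-1 R15.18 (6)(iv): the wild pinch, `AS3Pinch`, the `ASpPinch` family — centre `𝓘_D = (ȳ, t̄)`, exceptional curves
regular), and it weakens the chart hypothesis `hon` of `LineCentreEngine` from «chart regular at the points of `E`» to «`E` itself CM +
F-injective there» (`clause_of_regularExceptionalSlice` records the regular special case). [OURS · kernel glue; mathematics = Fedder 1983
Thm. 3.4 (1) as in the tree]
-/

-- single-problem summit: the doubled namespace component is forced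
set_option linter.dupNamespace false

noncomputable section

open Literature.AlgebraicGeometry.Resolution IsLocalRing

namespace Summit.ResolutionOfSingularities.ResolutionOfSingularities.Theorems.FInjectiveMacaulayfication.ExceptionalSlicesIdealCentre

open Summit.ResolutionOfSingularities.ResolutionOfSingularities.Theorems.FInjectiveMacaulayfication

/-- **R1 AT ONE POINT OF THE EXCEPTIONAL DIVISOR, ARBITRARY CENTRE.** `A` a Noetherian domain of characteristic `p`, `c : Fin n → A` nonzero,
`𝔔` a prime of the chart `A[(c)/c_j]` with `c_j/1 ∈ 𝔔`. If for every presentation `L` of the localisation at `𝔔` the slice `L ⧸ (c_j)`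
satisfies the CM clause and the F-clause, then `A[(c)/c_j]_𝔔` is a domain satisfying the full clause: `c_j/1` is a nonzerodivisor in the
maximal ideal of the local domain `A[(c)/c_j]_𝔔`, and CM + F-injective deform along it (`ExceptionalSlices.cmfiDeforms_clause`).
(`ExceptionalSlices.pfixData_of_exceptionalSlices` minus the hypotheses «`A` local», «`√(c) = 𝔪`», with «`𝔔` over `𝔪`» replaced by
«`c_j/1 ∈ 𝔔`»; proof otherwise verbatim.) [cite: Fedder1983, Thm. 3.4 (1)] [cite: StacksProject, Tag 07Z3] -/
theorem clause_of_exceptionalSlice {p : ℕ} (hp : p.Prime)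
    {A : Type} [CommRing A] [IsDomain A] [IsNoetherianRing A] [CharP A p]
    {n : ℕ} (c : Fin n → A) (j : Fin n) (hcj : c j ≠ 0)
    (𝔔 : PrimeSpectrum (blowupAlgebra (Ideal.span (Set.range c)) (c j)))
    (h𝔔 : algebraMap A (blowupAlgebra (Ideal.span (Set.range c)) (c j)) (c j) ∈ 𝔔.asIdeal)
    (hE : ∀ (L : Type) [CommRing L] [Algebra (blowupAlgebra (Ideal.span (Set.range c)) (c j)) L]
          [IsLocalization.AtPrime L 𝔔.asIdeal],
        (∀ d : ℕ, ringKrullDim (L ⧸ Ideal.span {algebraMap (blowupAlgebra (Ideal.span (Set.range c)) (c j)) L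
            (algebraMap A (blowupAlgebra (Ideal.span (Set.range c)) (c j)) (c j))}) = d →
          ∀ s : Fin d → (L ⧸ Ideal.span {algebraMap (blowupAlgebra (Ideal.span (Set.range c)) (c j)) L
            (algebraMap A (blowupAlgebra (Ideal.span (Set.range c)) (c j)) (c j))}), (Ideal.span (Set.range s)).radical.IsMaximal →
          RingTheory.Sequence.IsWeaklyRegular (L ⧸ Ideal.span {algebraMap (blowupAlgebra (Ideal.span (Set.range c)) (c j)) L
            (algebraMap A (blowupAlgebra (Ideal.span (Set.range c)) (c j)) (c j))}) (List.ofFn s)) ∧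
        (∀ d : ℕ, ringKrullDim (L ⧸ Ideal.span {algebraMap (blowupAlgebra (Ideal.span (Set.range c)) (c j)) L
            (algebraMap A (blowupAlgebra (Ideal.span (Set.range c)) (c j)) (c j))}) = d →
          ∀ s : Fin d → (L ⧸ Ideal.span {algebraMap (blowupAlgebra (Ideal.span (Set.range c)) (c j)) L
            (algebraMap A (blowupAlgebra (Ideal.span (Set.range c)) (c j)) (c j))}), (Ideal.span (Set.range s)).radical.IsMaximal →
          ∀ y : (L ⧸ Ideal.span {algebraMap (blowupAlgebra (Ideal.span (Set.range c)) (c j)) L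
            (algebraMap A (blowupAlgebra (Ideal.span (Set.range c)) (c j)) (c j))}),
            (∃ e : ℕ, y ^ p ^ e ∈ Ideal.span ((fun z : (L ⧸ Ideal.span {algebraMap (blowupAlgebra (Ideal.span (Set.range c)) (c j)) L
              (algebraMap A (blowupAlgebra (Ideal.span (Set.range c)) (c j)) (c j))}) => z ^ p ^ e) ''
              (Ideal.span (Set.range s) : Set (L ⧸ Ideal.span {algebraMap (blowupAlgebra (Ideal.span (Set.range c)) (c j)) L
                (algebraMap A (blowupAlgebra (Ideal.span (Set.range c)) (c j)) (c j))})))) →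
            y ∈ Ideal.span (Set.range s))) :
    IsDomain (Localization.AtPrime 𝔔.asIdeal) ∧ ∀ d : ℕ, ringKrullDim (Localization.AtPrime 𝔔.asIdeal) = d →
      ∀ s : Fin d → (Localization.AtPrime 𝔔.asIdeal), (Ideal.span (Set.range s)).radical.IsMaximal →
        RingTheory.Sequence.IsWeaklyRegular (Localization.AtPrime 𝔔.asIdeal) (List.ofFn s) ∧
        ∀ y : (Localization.AtPrime 𝔔.asIdeal), (∃ e : ℕ, y ^ p ^ e ∈ Ideal.span
          ((fun z : (Localization.AtPrime 𝔔.asIdeal) => z ^ p ^ e) '' (Ideal.span (Set.range s) : Set (Localization.AtPrime 𝔔.asIdeal)))) →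
          y ∈ Ideal.span (Set.range s) := by
  haveI : IsDomain (Localization.Away (c j)) :=
    IsLocalization.isDomain_localization (powers_le_nonZeroDivisors_of_noZeroDivisors hcj)
  haveI hBdom : IsDomain (blowupAlgebra (Ideal.span (Set.range c)) (c j)) := inferInstance
  haveI : IsNoetherianRing (blowupAlgebra (Ideal.span (Set.range c)) (c j)) :=
    isNoetherianRing_blowupAlgebra_of_isNoetherianRing (Ideal.span (Set.range c)) (c j)
  haveI hLdom : IsDomain (Localization.AtPrime 𝔔.asIdeal) :=
    IsLocalization.isDomain_localization (Ideal.primeCompl_le_nonZeroDivisors 𝔔.asIdeal)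
  haveI : IsNoetherianRing (Localization.AtPrime 𝔔.asIdeal) :=
    IsLocalization.isNoetherianRing 𝔔.asIdeal.primeCompl _ inferInstance
  haveI : CharP (Localization.AtPrime 𝔔.asIdeal) p :=
    CharP.of_ringHom_of_ne_zero ((algebraMap (blowupAlgebra (Ideal.span (Set.range c)) (c j))
      (Localization.AtPrime 𝔔.asIdeal)).comp (algebraMap A (blowupAlgebra (Ideal.span (Set.range c)) (c j)))) p hp.ne_zero
  -- the slice `t = c_j / 1`
  set t : Localization.AtPrime 𝔔.asIdeal := algebraMap (blowupAlgebra (Ideal.span (Set.range c)) (c j))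
      (Localization.AtPrime 𝔔.asIdeal) (algebraMap A (blowupAlgebra (Ideal.span (Set.range c)) (c j)) (c j)) with ht
  have ht𝔪 : t ∈ maximalIdeal (Localization.AtPrime 𝔔.asIdeal) := by
    rw [ht]
    exact (IsLocalization.AtPrime.to_map_mem_maximal_iff (Localization.AtPrime 𝔔.asIdeal) 𝔔.asIdeal _).mpr h𝔔
  have ht0 : t ≠ 0 := by
    rw [ht]
    intro h
    have hinj : Function.Injective (algebraMap (blowupAlgebra (Ideal.span (Set.range c)) (c j))
        (Localization.AtPrime 𝔔.asIdeal)) :=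
      IsLocalization.injective (Localization.AtPrime 𝔔.asIdeal) (Ideal.primeCompl_le_nonZeroDivisors 𝔔.asIdeal)
    have h0 : algebraMap A (blowupAlgebra (Ideal.span (Set.range c)) (c j)) (c j) = 0 :=
      hinj (by rw [h, map_zero])
    exact nonZeroDivisors.ne_zero algebraMap_mem_nonZeroDivisors_blowupAlgebra h0
  have htnzd : t ∈ nonZeroDivisors (Localization.AtPrime 𝔔.asIdeal) := mem_nonZeroDivisors_of_ne_zero ht0
  obtain ⟨hCM, hFI⟩ := hE (Localization.AtPrime 𝔔.asIdeal)
  have h := ExceptionalSlices.cmfiDeforms_clause p hp (Localization.AtPrime 𝔔.asIdeal) t ht𝔪 htnzd hCM hFI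
  exact ⟨hLdom, fun d hd s hs => ⟨h.1 d hd s hs, h.2 d hd s hs⟩⟩

/-- **Regular special case.** If for SOME presentation `L₀` of the localisation at `𝔔 ∋ c_j/1` the slice `L₀ ⧸ (c_j)` is a REGULAR local
ring, then `A[(c)/c_j]_𝔔` is a domain satisfying the full clause (regular ⇒ both clauses by
`RegularExceptionalSlices.cmClause_and_fClause_of_isRegularLocalRing`; any other presentation via `RegularExceptionalSlices.nonempty_sliceEquiv`).
[OURS assembly over the tree] -/
theorem clause_of_regularExceptionalSlice {p : ℕ} (hp : p.Prime)
    {A : Type} [CommRing A] [IsDomain A] [IsNoetherianRing A] [CharP A p]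
    {n : ℕ} (c : Fin n → A) (j : Fin n) (hcj : c j ≠ 0)
    (𝔔 : PrimeSpectrum (blowupAlgebra (Ideal.span (Set.range c)) (c j)))
    (h𝔔 : algebraMap A (blowupAlgebra (Ideal.span (Set.range c)) (c j)) (c j) ∈ 𝔔.asIdeal)
    (hReg : ∃ (L₀ : Type) (_ : CommRing L₀) (_ : Algebra (blowupAlgebra (Ideal.span (Set.range c)) (c j)) L₀)
        (_ : IsLocalization.AtPrime L₀ 𝔔.asIdeal),
      IsRegularLocalRing (L₀ ⧸ Ideal.span {algebraMap (blowupAlgebra (Ideal.span (Set.range c)) (c j)) L₀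
        (algebraMap A (blowupAlgebra (Ideal.span (Set.range c)) (c j)) (c j))})) :
    IsDomain (Localization.AtPrime 𝔔.asIdeal) ∧ ∀ d : ℕ, ringKrullDim (Localization.AtPrime 𝔔.asIdeal) = d →
      ∀ s : Fin d → (Localization.AtPrime 𝔔.asIdeal), (Ideal.span (Set.range s)).radical.IsMaximal →
        RingTheory.Sequence.IsWeaklyRegular (Localization.AtPrime 𝔔.asIdeal) (List.ofFn s) ∧
        ∀ y : (Localization.AtPrime 𝔔.asIdeal), (∃ e : ℕ, y ^ p ^ e ∈ Ideal.span
          ((fun z : (Localization.AtPrime 𝔔.asIdeal) => z ^ p ^ e) '' (Ideal.span (Set.range s) : Set (Localization.AtPrime 𝔔.asIdeal)))) →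
          y ∈ Ideal.span (Set.range s) := by
  refine clause_of_exceptionalSlice hp c j hcj 𝔔 h𝔔 fun L _ _ _ => ?_
  obtain ⟨L₀, _, _, _, hR⟩ := hReg
  haveI := hR
  obtain ⟨e⟩ := RegularExceptionalSlices.nonempty_sliceEquiv 𝔔.asIdeal L₀ L
    (algebraMap A (blowupAlgebra (Ideal.span (Set.range c)) (c j)) (c j))
  haveI : IsRegularLocalRing (L ⧸ Ideal.span {algebraMap (blowupAlgebra (Ideal.span (Set.range c)) (c j)) L
      (algebraMap A (blowupAlgebra (Ideal.span (Set.range c)) (c j)) (c j))}) := IsRegularLocalRing.of_ringEquiv (e := e)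
  haveI : CharP (L ⧸ Ideal.span {algebraMap (blowupAlgebra (Ideal.span (Set.range c)) (c j)) L
      (algebraMap A (blowupAlgebra (Ideal.span (Set.range c)) (c j)) (c j))}) p :=
    CharP.of_ringHom_of_ne_zero ((Ideal.Quotient.mk _).comp ((algebraMap (blowupAlgebra (Ideal.span (Set.range c)) (c j)) L).comp
      (algebraMap A (blowupAlgebra (Ideal.span (Set.range c)) (c j))))) p hp.ne_zero
  exact RegularExceptionalSlices.cmClause_and_fClause_of_isRegularLocalRing hp _

end Summit.ResolutionOfSingularities.ResolutionOfSingularities.Theorems.FInjectiveMacaulayfication.ExceptionalSlicesIdealCentre
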